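import Literature.MathematicalPhysics.QuantumFieldTheory.YangMillsOS
import Literature.MathematicalPhysics.QuantumFieldTheory.LatticeMassGap
import Literature.MathematicalPhysics.QuantumFieldTheory.LatticeMassGapProofs
import Literature.MathematicalPhysics.QuantumFieldTheory.LatticeGaugeProofs
import Literature.MathematicalPhysics.QuantumFieldTheory.ConstructiveQFTWave0OddRPProofs
import Literature.Probability.LatticeModels.OSReconstruction
import Literature.MathematicalPhysics.QuantumLattice.LatticeGaugeDLR
import Literature.MathematicalPhysics.QuantumFieldTheory.GaugeOSData
import HarnessLib

/-!
# Stub `stub_reconstructible` of crux `ClusteringToYangMills` (stmt-QuantumFields-9443),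
line `spectral-requantisation-dock` — part 1/3: geometry of the time reflection and the time shift

Helper file (1 of 3) for the stub `stub_reconstructible`
(`FradkinShenkerFlowClusteringToYangMillsStubReconstructible.lean`): the premises
`IsOSReconstructible μ Θ τ 𝓔₊` of the lattice Osterwalder–Schrader reconstruction for odd-torus
limit states of lattice Yang–Mills, with `Θ = gaugeTimeReflect`, `τ = gaugeTimeShift`,
`𝓔₊ = posTimeEvents G` (`Literature/MathematicalPhysics/QuantumFieldTheory/GaugeOSData.lean`).

**Content of this part** (namespace `…ClusteringToYangMills.Reconstructible`).
* Geometry on `ℤ⁴`: `Θ ∘ Θ = id` (`gaugeTimeReflect_gaugeTimeReflect`), `τ ∘ Θ ∘ τ = Θ`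
  (`gaugeTimeShift_gaugeTimeReflect_gaugeTimeShift`), measurability / continuity of `Θ`, `τ`,
  `𝓔₊`-measurability of `τ` (`x₀ ≥ 0 → x₀ + 1 ≥ 0`), and cylinder observables stay cylinder
  observables under `Θ`, `τ`.
* The torus side (Wave 0's torus bond reflection `Θ_T = GaugeConfig.timeReflect`, `t ↦ 1 - t`,
  and the torus translations `T_v = torusConfigShift v`): `Θ_T ∘ T_{ce₀} = T_{-ce₀} ∘ Θ_T`
  (`timeReflect_torusConfigShift_single`); the periodic lift intertwines
  `Θ ∘ torusLift = torusLift ∘ T_{-2e₀} ∘ Θ_T` (`gaugeTimeReflect_torusLift`) and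
  `τ ∘ torusLift = torusLift ∘ T_{-e₀}` (`gaugeTimeShift_torusLift`); the torus Wilson state is
  `Θ_T`-invariant (`wilsonMeasure_map_timeReflect`, `wilsonExpectation_comp_timeReflect`: product
  Haar measure by `WilsonRP.measurePreserving_timeReflect`, Boltzmann weight by
  `WilsonRP.plaqRe_timeReflect`).

**Sources.** K. Osterwalder, E. Seiler, Ann. Phys. 110 (1978) 440, §2; E. Seiler, LNP 159
(1982), Ch. 2; J. Glimm, A. Jaffe, *Quantum Physics* (1987), §6.1.
-/

noncomputable section

open scoped BigOperators Topology ENNReal InnerProductSpace ComplexConjugate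
open MeasureTheory Filter

open Literature.MathematicalPhysics.QuantumFieldTheory Literature.MathematicalPhysics.QuantumLattice
open Literature.Probability.LatticeModels (IsOSReconstructible IsBoundedMeasurable positiveEvents
  TransferData)

namespace Summit.QuantumFields.YangMills.Theorems.ClusteringToYangMills.Reconstructible

/-! ### Geometry of the bond reflection `Θ` and the time shift `τ` on `ℤ⁴` -/

section GeometryZ4

variable {G : Type} [Group G]

/-- `θ(θ(x + e₀) + e₀) = x` for the site reflection `θ : x₀ ↦ -1 - x₀`. [folklore] -/
theorem latticeTimeReflection_latticeTimeReflection_add_add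
    (x : Literature.Probability.LatticeModels.Site 4) :
    latticeTimeReflection 4 (latticeTimeReflection 4 (x + Pi.single 0 1) + Pi.single 0 1) = x := by
  ext j
  by_cases hj : j = 0
  · subst hj; simp; ring
  · simp [hj]

/-- `θ(x + e₀) + e₀ = θ x`. [folklore] -/
theorem latticeTimeReflection_add_add (x : Literature.Probability.LatticeModels.Site 4) :
    latticeTimeReflection 4 (x + Pi.single 0 1) + Pi.single 0 1 = latticeTimeReflection 4 x := by
  ext j
  by_cases hj : j = 0
  · subst hj; simp; ring
  · simp [hj]

/-- **`Θ` is an involution**: `Θ (Θ U) = U`. [folklore] -/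
theorem gaugeTimeReflect_gaugeTimeReflect (U : LGConfig 4 G) :
    gaugeTimeReflect (gaugeTimeReflect U) = U := by
  funext e
  rcases e with ⟨x, i⟩
  by_cases hi : i = 0
  · subst hi
    simp [gaugeTimeReflect_apply, -latticeTimeReflection_apply,
      latticeTimeReflection_latticeTimeReflection_add_add]
  · simp [gaugeTimeReflect_apply, hi, -latticeTimeReflection_apply,
      latticeTimeReflection_involutive 4 x]

/-- **`τ ∘ Θ ∘ τ = Θ`** (equivalently `Θ τ Θ = τ⁻¹`). [folklore] -/
theorem gaugeTimeShift_gaugeTimeReflect_gaugeTimeShift [MeasurableSpace G] (U : LGConfig 4 G) :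
    gaugeTimeShift (gaugeTimeReflect (gaugeTimeShift U)) = gaugeTimeReflect U := by
  funext e
  rcases e with ⟨x, i⟩
  by_cases hi : i = 0
  · subst hi
    simp [gaugeTimeReflect_apply, -latticeTimeReflection_apply, latticeTimeReflection_add_add]
  · simp [gaugeTimeReflect_apply, hi, -latticeTimeReflection_apply, latticeTimeReflection_add_add]

/-- `Θ` is measurable. [folklore] -/
theorem measurable_gaugeTimeReflect [MeasurableSpace G] [MeasurableInv G] :
    Measurable (gaugeTimeReflect : LGConfig 4 G → LGConfig 4 G) := by
  refine measurable_pi_lambda _ fun e => ?_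
  simp only [gaugeTimeReflect_apply]
  split_ifs
  · exact (measurable_pi_apply _).inv
  · exact measurable_pi_apply _

/-- `Θ` is continuous. [folklore] -/
theorem continuous_gaugeTimeReflect [TopologicalSpace G] [ContinuousInv G] :
    Continuous (gaugeTimeReflect : LGConfig 4 G → LGConfig 4 G) := by
  refine continuous_pi fun e => ?_
  simp only [gaugeTimeReflect_apply]
  split_ifs
  · exact (continuous_apply _).inv
  · exact continuous_apply _

/-- `Θ` as a measurable equivalence (it is a measurable involution). [folklore] -/
theorem exists_measurableEquiv_gaugeTimeReflect [MeasurableSpace G] [MeasurableInv G] :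
    ∃ e : LGConfig 4 G ≃ᵐ LGConfig 4 G, (e : LGConfig 4 G → LGConfig 4 G) = gaugeTimeReflect :=
  ⟨⟨⟨gaugeTimeReflect, gaugeTimeReflect, gaugeTimeReflect_gaugeTimeReflect,
    gaugeTimeReflect_gaugeTimeReflect⟩, measurable_gaugeTimeReflect, measurable_gaugeTimeReflect⟩, rfl⟩

omit [Group G] in
/-- `τ` is continuous. [folklore] -/
theorem continuous_gaugeTimeShift [TopologicalSpace G] [MeasurableSpace G] :
    Continuous (gaugeTimeShift : LGConfig 4 G → LGConfig 4 G) :=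
  continuous_configShift _

omit [Group G] in
/-- `τ` is measurable. [folklore] -/
theorem measurable_gaugeTimeShift [MeasurableSpace G] :
    Measurable (gaugeTimeShift : LGConfig 4 G → LGConfig 4 G) :=
  (configShift _).measurable

omit [Group G] in
/-- **`τ` maps `𝓔₊` into itself**: it is `𝓔₊`-`𝓔₊`-measurable (`x₀ ≥ 0 → x₀ + 1 ≥ 0`). [folklore] -/
theorem measurable_gaugeTimeShift_posTimeEvents [MeasurableSpace G] :
    Measurable[posTimeEvents G, posTimeEvents G] (gaugeTimeShift : LGConfig 4 G → LGConfig 4 G) := by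
  rw [measurable_cylinderEvents_iff]
  intro e he
  have he' : (e.1 + Pi.single 0 1, e.2) ∈ posTimeEdges := by
    simp only [mem_posTimeEdges, Pi.add_apply, Pi.single_eq_same] at he ⊢
    omega
  simpa [gaugeTimeShift_apply] using
    measurable_cylinderEvent_apply (X := fun _ : Literature.MathematicalPhysics.QuantumLattice.ZdEdge 4 => G) he'

/-- A cylinder observable composed with `Θ` is a cylinder observable. [folklore] -/
theorem isCylinder_comp_gaugeTimeReflect {α : Type*} {F : LGConfig 4 G → α} {Λ : Finset (Literature.MathematicalPhysics.QuantumLattice.ZdEdge 4)}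
    (hF : IsCylinder F Λ) :
    IsCylinder (F ∘ gaugeTimeReflect) (Λ.image fun e =>
      if e.2 = 0 then (latticeTimeReflection 4 (e.1 + Pi.single 0 1), 0)
        else (latticeTimeReflection 4 e.1, e.2)) := by
  intro U V hUV
  simp only [Function.comp_apply]
  refine hF fun e he => ?_
  have h : U (if e.2 = 0 then (latticeTimeReflection 4 (e.1 + Pi.single 0 1), 0)
      else (latticeTimeReflection 4 e.1, e.2)) =
      V (if e.2 = 0 then (latticeTimeReflection 4 (e.1 + Pi.single 0 1), 0)
      else (latticeTimeReflection 4 e.1, e.2)) :=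
    hUV _ (Finset.mem_coe.2 (Finset.mem_image_of_mem _ (Finset.mem_coe.1 he)))
  simp only [gaugeTimeReflect_apply]
  split_ifs with h0
  · rw [if_pos h0] at h
    rw [h]
  · rw [if_neg h0] at h
    rw [h]

omit [Group G] in
/-- A cylinder observable composed with `τ` is a cylinder observable. [folklore] -/
theorem isCylinder_comp_gaugeTimeShift [MeasurableSpace G] {α : Type*} {F : LGConfig 4 G → α}
    {Λ : Finset (Literature.MathematicalPhysics.QuantumLattice.ZdEdge 4)} (hF : IsCylinder F Λ) :
    IsCylinder (F ∘ gaugeTimeShift) (Λ.image fun e => (e.1 + Pi.single 0 1, e.2)) := by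
  intro U V hUV
  simp only [Function.comp_apply]
  refine hF fun e he => ?_
  simp only [gaugeTimeShift_apply]
  exact hUV _ (Finset.mem_coe.2 (Finset.mem_image_of_mem _ (Finset.mem_coe.1 he)))

end GeometryZ4

/-! ### The torus side: bond reflection, translations and the periodic lift -/

section Torus

variable {G : Type} [Group G] {L : ℕ}

/-- `θ_T (x + c e₀) = θ_T x - c e₀` for the torus reflection `θ_T : t ↦ 1 - t`. [folklore] -/
theorem timeReflect_add_single (x : Site 4 L) (c : ZMod L) :
    Site.timeReflect (x + Pi.single 0 c) = Site.timeReflect x - Pi.single 0 c := by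
  funext j
  by_cases hj : j = 0
  · subst hj; simp [Site.timeReflect]; ring
  · simp [Site.timeReflect, hj]

/-- `(x + v) + e₀ = (x + e₀) + v`. [folklore] -/
theorem shift_add (x v : Site 4 L) : Site.shift (x + v) 0 = Site.shift x 0 + v := by
  simp only [Site.shift]; abel

/-- **Time translations are conjugated to their inverses by `Θ_T`**:
`Θ_T (T_{c e₀} U) = T_{-c e₀} (Θ_T U)`. [folklore] -/
theorem timeReflect_torusConfigShift_single [MeasurableSpace G] (c : ZMod L) (U : GaugeConfig 4 L G) :
    GaugeConfig.timeReflect (torusConfigShift (Pi.single 0 c) U) =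
      torusConfigShift (Pi.single 0 (-c)) (GaugeConfig.timeReflect U) := by
  funext e
  rcases e with ⟨x, i⟩
  simp only [GaugeConfig.timeReflect, torusConfigShift_apply, Pi.single_neg, sub_neg_eq_add, shift_add,
    timeReflect_add_single]

omit [Group G] in
/-- Composition of torus translations. [folklore] -/
theorem torusConfigShift_torusConfigShift [MeasurableSpace G] (a b : Site 4 L) (U : GaugeConfig 4 L G) :
    torusConfigShift a (torusConfigShift b U) = torusConfigShift (a + b) U := by
  funext e
  simp only [torusConfigShift_apply, sub_sub]

omit [Group G] in
/-- The trivial translation. [folklore] -/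
theorem torusConfigShift_zero [MeasurableSpace G] (U : GaugeConfig 4 L G) :
    torusConfigShift (0 : Site 4 L) U = U := by
  funext e
  simp only [torusConfigShift_apply, sub_zero, Prod.mk.eta]

/-- The periodic lift intertwines `θ` with `θ_T` up to a translation by `2 e₀`:
`proj (θ x) = θ_T (proj x + 2 e₀)`. [folklore] -/
theorem proj_latticeTimeReflection (x : Literature.Probability.LatticeModels.Site 4) :
    Literature.Probability.LatticeModels.Torus.proj L (latticeTimeReflection 4 x) =
      Site.timeReflect (Literature.Probability.LatticeModels.Torus.proj L x - Pi.single 0 (-2)) := by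
  funext j
  by_cases hj : j = 0
  · subst hj; simp [Site.timeReflect]; ring
  · simp [Site.timeReflect, hj]

/-- `proj (θ (x + e₀)) = θ_T (proj x + 2 e₀ + e₀)`. [folklore] -/
theorem proj_latticeTimeReflection_add (x : Literature.Probability.LatticeModels.Site 4) :
    Literature.Probability.LatticeModels.Torus.proj L (latticeTimeReflection 4 (x + Pi.single 0 1)) =
      Site.timeReflect (Site.shift
        (Literature.Probability.LatticeModels.Torus.proj L x - Pi.single 0 (-2)) 0) := by
  funext j
  by_cases hj : j = 0
  · subst hj; simp [Site.timeReflect, Site.shift]; ring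
  · simp [Site.timeReflect, Site.shift, hj]

/-- `proj (x + e₀) = proj x + e₀`. [folklore] -/
theorem proj_add_single (x : Literature.Probability.LatticeModels.Site 4) :
    Literature.Probability.LatticeModels.Torus.proj L (x + Pi.single 0 1) =
      Literature.Probability.LatticeModels.Torus.proj L x - Pi.single 0 (-1) := by
  funext j
  by_cases hj : j = 0
  · subst hj; simp
  · simp [hj]

/-- **The periodic lift intertwines the bond reflections**:
`Θ (torusLift U) = torusLift (T_{-2e₀} (Θ_T U))`. [folklore] -/
theorem gaugeTimeReflect_torusLift [MeasurableSpace G] (U : GaugeConfig 4 L G) :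
    gaugeTimeReflect (torusLift L U) =
      torusLift L (torusConfigShift (Pi.single 0 (-2)) (GaugeConfig.timeReflect U)) := by
  funext e
  rcases e with ⟨x, i⟩
  rw [gaugeTimeReflect_apply]
  simp only [torusLift, Function.comp_apply, torusEdge, torusConfigShift_apply, GaugeConfig.timeReflect]
  rw [proj_latticeTimeReflection_add, proj_latticeTimeReflection]

omit [Group G] in
/-- **The periodic lift intertwines the time shifts**: `τ (torusLift U) = torusLift (T_{-e₀} U)`. [folklore] -/
theorem gaugeTimeShift_torusLift [MeasurableSpace G] (U : GaugeConfig 4 L G) :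
    gaugeTimeShift (torusLift L U) = torusLift L (torusConfigShift (Pi.single 0 (-1)) U) := by
  funext e
  simp only [gaugeTimeShift_apply, torusLift, Function.comp_apply, torusEdge,
    torusConfigShift_apply, proj_add_single]

/-- `Θ_T` is an involution on configurations. [folklore] -/
theorem timeReflect_timeReflect_config (U : GaugeConfig 4 L G) : U.timeReflect.timeReflect = U := by
  funext e
  have h2 : (WilsonRP.edgeReflect e).2 = e.2 := by
    unfold WilsonRP.edgeReflect; split_ifs with h <;> simp [h]
  rw [WilsonRP.timeReflect_apply, WilsonRP.timeReflect_apply, h2, WilsonRP.edgeReflect_edgeReflect]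
  split_ifs <;> simp

variable [TopologicalSpace G] [IsTopologicalGroup G] [CompactSpace G] [MeasurableSpace G] [BorelSpace G]

omit [CompactSpace G] in
/-- `Θ_T` as a measurable equivalence. [folklore] -/
theorem exists_measurableEquiv_timeReflect :
    ∃ e : GaugeConfig 4 L G ≃ᵐ GaugeConfig 4 L G,
      (e : GaugeConfig 4 L G → GaugeConfig 4 L G) = GaugeConfig.timeReflect :=
  ⟨⟨⟨GaugeConfig.timeReflect, GaugeConfig.timeReflect, timeReflect_timeReflect_config,
    timeReflect_timeReflect_config⟩, WilsonRP.measurable_timeReflect, WilsonRP.measurable_timeReflect⟩,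
    rfl⟩

variable {N : ℕ} (ρ : G →* Matrix (Fin N) (Fin N) ℂ)

omit [MeasurableSpace G] [BorelSpace G] in
/-- **The Wilson action is `Θ_T`-invariant** (any torus size). [folklore] -/
theorem wilsonAction_timeReflect [NeZero L] (hρ : Continuous ρ) (U : GaugeConfig 4 L G) :
    wilsonAction ρ U.timeReflect = wilsonAction ρ U := by
  unfold wilsonAction
  have h : ∀ p : Plaquette 4 L,
      (ρ (plaquetteHolonomy U.timeReflect p.1 p.2.1.1 p.2.1.2)).trace.re =
        (ρ (plaquetteHolonomy U (WilsonRP.plaqReflect p).1 (WilsonRP.plaqReflect p).2.1.1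
          (WilsonRP.plaqReflect p).2.1.2)).trace.re :=
    fun p => WilsonRP.plaqRe_timeReflect ρ hρ U p
  simp_rw [h]
  exact Fintype.sum_equiv WilsonRP.plaqReflectEquiv _ _ (fun p => rfl)

/-- **The torus Wilson state is `Θ_T`-invariant** (product Haar measure is invariant under the
link permutation-and-inversion `Θ_T`, the Boltzmann weight by `wilsonAction_timeReflect`). [folklore] -/
theorem wilsonMeasure_map_timeReflect [NeZero L] (hρ : Continuous ρ) (β : ℝ) :
    (wilsonMeasure (d := 4) (L := L) ρ β).map GaugeConfig.timeReflect = wilsonMeasure ρ β := by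
  obtain ⟨e, he⟩ := exists_measurableEquiv_timeReflect (G := G) (L := L)
  have hπ : (Measure.pi fun _ : Edge 4 L => haarProbability G).map e =
      Measure.pi fun _ => haarProbability G := by
    rw [he]
    exact (WilsonRP.measurePreserving_timeReflect (d := 4) (L := L) (G := G)).map_eq
  rw [← he]
  simp only [wilsonMeasure, Measure.map_smul, wilsonWeight]
  rw [withDensity_map_of_measurableEquiv _ e _ hπ]
  intro U
  rw [he, wilsonAction_timeReflect ρ hρ]

/-- Torus Wilson expectations are `Θ_T`-invariant. [folklore] -/
theorem wilsonExpectation_comp_timeReflect [NeZero L] (hρ : Continuous ρ) (β : ℝ) {V : Type*}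
    [NormedAddCommGroup V] [NormedSpace ℝ V] (F : GaugeConfig 4 L G → V) :
    wilsonExpectation ρ β (F ∘ GaugeConfig.timeReflect) = wilsonExpectation ρ β F := by
  obtain ⟨e, he⟩ := exists_measurableEquiv_timeReflect (G := G) (L := L)
  simp only [wilsonExpectation, Function.comp_apply]
  rw [← he, ← integral_map_equiv e, he, wilsonMeasure_map_timeReflect ρ hρ]

end Torus

end Summit.QuantumFields.YangMills.Theorems.ClusteringToYangMills.Reconstructible

namespace Summit.QuantumFields.YangMills.Theorems.ClusteringToYangMills

/-- **Registered sub-goal `stub_reconstructible_geometry` of stub `stub_reconstructible`** (part 1/3):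
the periodic lift intertwines the bond reflection `Θ` and the time shift `τ` of `ℤ⁴` gauge fields
with `T_{-2e₀} ∘ Θ_T` and `T_{-e₀}` on every torus (`Θ_T` = Wave 0's `GaugeConfig.timeReflect`,
`T_v = torusConfigShift v`). [folklore] -/
theorem stub_reconstructible_geometry :
    ∀ (G : Type) [Group G] [MeasurableSpace G] (L : ℕ) (U : GaugeConfig 4 L G),
      gaugeTimeReflect (torusLift L U) =
          torusLift L (torusConfigShift (Pi.single 0 (-2)) (GaugeConfig.timeReflect U)) ∧
        gaugeTimeShift (torusLift L U) = torusLift L (torusConfigShift (Pi.single 0 (-1)) U) :=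
  fun _ _ _ _ U => ⟨Reconstructible.gaugeTimeReflect_torusLift U, Reconstructible.gaugeTimeShift_torusLift U⟩

end Summit.QuantumFields.YangMills.Theorems.ClusteringToYangMills

end
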